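import Mathlib.Topology.Compactness.Compact
import Mathlib.Topology.Constructions
import Mathlib.Topology.Algebra.Group.Basic
import Mathlib.Data.Finset.Order
import Mathlib.Algebra.Group.Subgroup.Basic
import HarnessLib

/-!
# Lifting compatible families along maps of inverse systems over a DIRECTED index set
# (Mittag-Leffler by compactness, carrier-free)

An inverse system of abelian groups over a directed preorder `ι` is given here as EXPLICIT DATA: groups
`A i` and transition homomorphisms `TA h : A j →+ A i` for `h : i ≤ j`, composable
(`TA hij (TA hjk x) = TA (hij.trans hjk) x`); a family `a : Π i, A i` is COMPATIBLE when
`TA h (a j) = a i` for all `i ≤ j` (Atiyah–Macdonald, Ch. 10, "coherent sequences"; Mathlib's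
`InverseSystem`). No limit object is formed: every statement quantifies over compatible families.
This is the interface in which the tree's towers actually come — e.g. the layer restriction maps
`resOfLe (h : n ≤ n')` of a `ℤ_p`-extension, the doubly indexed `(n, m)` = (layer, `p`-power level)
families of the `Λ`-adic Selmer carriers (index set `ℕ × ℕ` with the product order) — and it subsumes
the `ℕ`-towers of `AddInverseLimitExact.lean` (one-step transitions iterate to such a system).

* `exists_compatible_sub_of_finset` — FINITE-STAGE SOLVABILITY: for a map of systems `f : A → B`, a
  compatible `x ∈ Π B i` and preimages `a i ∈ f_i⁻¹(x i)`, and any finite set `s` of comparable pairs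
  `i ≤ j`, there is a correction `k ∈ Π ker f_i` making `a - k` compatible along every pair of `s`
  (take an upper bound `u` of the indices of `s` — directedness — and `k i := a i - TA (a u)`).
* `exists_compatible_preimage_of_finite_ker` — **THE LIFTING LEMMA**: if every kernel `ker f_i` is
  FINITE, every compatible family `x` with `x i ∈ range f_i` for all `i` is `f(a)` for a COMPATIBLE
  family `a` (compactness of `Π i, ker f_i`: the finite-stage solution sets are closed, non-empty and
  directed, so they have a common point — Mittag-Leffler in König's-lemma form).
* `exists_compatible_preimage_of_isCompact_ker` — the same for Hausdorff topological groups `A i`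
  with continuous transition maps and COMPACT kernels (profinite kernel systems).
* Consequences: `forall_exists_compatible_preimage_of_surjective_of_finite_ker` (levelwise onto with
  finite kernels ⟹ onto on compatible families) and `…_of_finite` (systems of finite groups).

All statements are proved; there are no named facts and no definitions in this file.

## Why (where this is used)

Passing a levelwise exact sequence of FINITE groups (finite-level Poitou–Tate / Cassels–Tate /
local duality sequences) to compatible families over the whole index set — the "`lim←` is exact on
Mittag-Leffler systems" step of Λ-adic arguments (Castella–Wan 2024 (6.12)–(6.13); Perrin-Riou §1.3.3;
Greenberg) — for index sets such as `ℕ × ℕ` without choosing a cofinal chain. Nothing is asserted about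
any arithmetic object.

References: [AtiyahMacdonald1969] Ch. 10, Prop. 10.2 and pp. 103–104 (inverse systems, coherent
sequences, exactness); [Weibel1994] §3.5, Def. 3.5.6 / Prop. 3.5.7 (Mittag-Leffler).
-/

namespace Literature.Algebra.InverseSystem

universe u v w

open Function

section Directed

variable {ι : Type u} [Preorder ι] [IsDirectedOrder ι]
  {A : ι → Type v} {B : ι → Type w} [∀ i, AddCommGroup (A i)] [∀ i, AddCommGroup (B i)]
  {TA : ∀ ⦃i j : ι⦄, i ≤ j → A j →+ A i} {TB : ∀ ⦃i j : ι⦄, i ≤ j → B j →+ B i}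
  {f : ∀ i, A i →+ B i}

/-- **Finite-stage solvability.** Let `f : A → B` be a map of inverse systems over a directed preorder
(`hf : TB h ∘ f_j = f_i ∘ TA h`, `hTA`: the transitions of `A` compose), `x` a compatible family of `B`,
and `a i` preimages of `x i`. For every FINITE set `s` of comparable pairs there is `k ∈ Π ker f_i` such
that `a - k` is compatible along every pair of `s`: with `u` an upper bound of the indices occurring in
`s`, put `k i := a i - TA (a u)` for `i ≤ u` (it lies in `ker f_i` because `x` and `f` are compatible)
and `k i := 0` otherwise; then `(a - k) i = TA_{i ≤ u}(a u)` on the indices of `s`, which is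
compatible by composability. [cite: AtiyahMacdonald1969, Ch. 10, pp. 103–104 (inverse systems over a directed set; coherent sequences)] -/
theorem exists_compatible_sub_of_finset [Nonempty ι]
    (hTA : ∀ ⦃i j k : ι⦄ (hij : i ≤ j) (hjk : j ≤ k) (x : A k), TA hij (TA hjk x) = TA (hij.trans hjk) x)
    (hf : ∀ ⦃i j : ι⦄ (h : i ≤ j) (y : A j), TB h (f j y) = f i (TA h y))
    {x : ∀ i, B i} (hx : ∀ ⦃i j : ι⦄ (h : i ≤ j), TB h (x j) = x i)
    (a : ∀ i, A i) (ha : ∀ i, f i (a i) = x i) (s : Finset (Σ' (i j : ι), i ≤ j)) :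
    ∃ k : ∀ i, A i, (∀ i, f i (k i) = 0) ∧
      ∀ q ∈ s, TA q.2.2 (a q.2.1 - k q.2.1) = a q.1 - k q.1 := by
  classical
  -- an upper bound of all indices occurring in `s`
  obtain ⟨u, hu⟩ := Finset.exists_le (s.image (fun q ↦ q.1) ∪ s.image (fun q ↦ q.2.1))
  have hu1 : ∀ q ∈ s, q.1 ≤ u := fun q hq ↦
    hu _ (Finset.mem_union_left _ (Finset.mem_image_of_mem _ hq))
  have hu2 : ∀ q ∈ s, q.2.1 ≤ u := fun q hq ↦
    hu _ (Finset.mem_union_right _ (Finset.mem_image_of_mem _ hq))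
  -- the correction: `k i := a i - TA (a u)` for `i ≤ u`, `0` otherwise
  refine ⟨fun i ↦ if h : i ≤ u then a i - TA h (a u) else 0, fun i ↦ ?_, fun q hq ↦ ?_⟩
  · by_cases h : i ≤ u
    · simp only [dif_pos h, map_sub, ha, ← hf, hx, sub_self]
    · simp only [dif_neg h, map_zero]
  · simp only [dif_pos (hu1 q hq), dif_pos (hu2 q hq), sub_sub_cancel, hTA]

/-- **The lifting lemma over a directed index set, abstract Mittag-Leffler form.** Hypotheses as in
`exists_compatible_sub_of_finset`; suppose moreover that the kernels carry compact Hausdorff topologies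
for which the restricted transition maps are continuous — packaged concretely: topologies on the `A i`
making them Hausdorff topological groups, with continuous transitions and COMPACT kernels. Then every
compatible family `x` with `x i ∈ range f_i` for all `i` lifts to a COMPATIBLE family `a` with
`f_i (a i) = x i`. Proof: choose preimages `a`; in the compact space `Π i, ker f_i` the sets
`C_q = {k | TA (a j - k j) = a i - k i}` (`q = (i ≤ j)`) are closed, and every finite intersection of
them is non-empty (`exists_compatible_sub_of_finset`); by compactness (Cantor / König) they have a common
point `k`, and `a - k` is the lift. [cite: Weibel1994, §3.5 Def. 3.5.6 and Prop. 3.5.7 (Mittag-Leffler ⟹ exactness of lim←)]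
[cite: AtiyahMacdonald1969, Ch. 10, Prop. 10.2] -/
theorem exists_compatible_preimage_of_isCompact_ker [∀ i, TopologicalSpace (A i)]
    [∀ i, IsTopologicalAddGroup (A i)] [∀ i, T2Space (A i)]
    (hTA : ∀ ⦃i j k : ι⦄ (hij : i ≤ j) (hjk : j ≤ k) (x : A k), TA hij (TA hjk x) = TA (hij.trans hjk) x)
    (hcont : ∀ ⦃i j : ι⦄ (h : i ≤ j), Continuous (TA h))
    (hf : ∀ ⦃i j : ι⦄ (h : i ≤ j) (y : A j), TB h (f j y) = f i (TA h y))
    (hker : ∀ i, IsCompact ((f i).ker : Set (A i)))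
    {x : ∀ i, B i} (hx : ∀ ⦃i j : ι⦄ (h : i ≤ j), TB h (x j) = x i)
    (hxr : ∀ i, x i ∈ (f i).range) :
    ∃ a : ∀ i, A i, (∀ ⦃i j : ι⦄ (h : i ≤ j), TA h (a j) = a i) ∧ ∀ i, f i (a i) = x i := by
  classical
  rcases isEmpty_or_nonempty ι with hι | hι
  · exact ⟨fun i ↦ isEmptyElim i, fun i ↦ isEmptyElim i, fun i ↦ isEmptyElim i⟩
  choose a ha using hxr
  haveI : ∀ i, CompactSpace (f i).ker := fun i ↦ isCompact_iff_compactSpace.1 (hker i)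
  -- the constraint sets in the compact space `Π i, ker f_i`
  let C : (Σ' (i j : ι), i ≤ j) → Set (∀ i, (f i).ker) := fun q ↦
    {k | TA q.2.2 (a q.2.1 - (k q.2.1 : A q.2.1)) = a q.1 - (k q.1 : A q.1)}
  have hC : ∀ q, IsClosed (C q) := by
    intro q
    refine isClosed_eq ?_ ?_
    · exact (hcont q.2.2).comp
        (continuous_const.sub (continuous_subtype_val.comp (continuous_apply q.2.1)))
    · exact continuous_const.sub (continuous_subtype_val.comp (continuous_apply q.1))
  -- finite intersections, indexed by finsets of pairs: closed, non-empty, directed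
  let t : Finset (Σ' (i j : ι), i ≤ j) → Set (∀ i, (f i).ker) := fun s ↦ ⋂ q ∈ s, C q
  have htc : ∀ s, IsClosed (t s) := fun s ↦
    isClosed_biInter fun q _ ↦ hC q
  have htn : ∀ s, (t s).Nonempty := by
    intro s
    obtain ⟨k, hk0, hk⟩ := exists_compatible_sub_of_finset hTA hf hx a ha s
    refine ⟨fun i ↦ ⟨k i, (f i).mem_ker.2 (hk0 i)⟩, ?_⟩
    simp only [t, Set.mem_iInter]
    intro q hq
    exact hk q hq
  have htd : Directed (· ⊇ ·) t := by
    intro s s'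
    refine ⟨s ∪ s', ?_, ?_⟩ <;>
      exact Set.biInter_subset_biInter_left (by simp)
  obtain ⟨k, hk⟩ := IsCompact.nonempty_iInter_of_directed_nonempty_isCompact_isClosed t htd htn
    (fun s ↦ (htc s).isCompact) htc
  -- `k` satisfies every constraint
  have hkq : ∀ q, k ∈ C q := fun q ↦ by
    have := Set.mem_iInter.1 hk {q}
    simpa [t] using this
  refine ⟨fun i ↦ a i - (k i : A i), fun i j h ↦ hkq ⟨i, j, h⟩, fun i ↦ ?_⟩
  rw [map_sub, ha, (f i).mem_ker.1 (k i).2, sub_zero]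

/-- **The lifting lemma over a directed index set, FINITE kernels** (the case of use: systems of finite
groups, e.g. finite-level Galois cohomology with finite coefficients): for a map `f : A → B` of inverse
systems over a directed preorder with composable transitions and every `ker f_i` finite, every
compatible family `x` of `B` with `x i ∈ range f_i` for all `i` is `f(a)` for a COMPATIBLE family `a`
of `A`. (Discrete topologies; `exists_compatible_preimage_of_isCompact_ker`.)
[cite: Weibel1994, §3.5 Prop. 3.5.7 (towers of finite groups are Mittag-Leffler)] [cite: AtiyahMacdonald1969, Ch. 10, Prop. 10.2] -/
theorem exists_compatible_preimage_of_finite_ker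
    (hTA : ∀ ⦃i j k : ι⦄ (hij : i ≤ j) (hjk : j ≤ k) (x : A k), TA hij (TA hjk x) = TA (hij.trans hjk) x)
    (hf : ∀ ⦃i j : ι⦄ (h : i ≤ j) (y : A j), TB h (f j y) = f i (TA h y))
    (hfin : ∀ i, Finite (f i).ker)
    {x : ∀ i, B i} (hx : ∀ ⦃i j : ι⦄ (h : i ≤ j), TB h (x j) = x i)
    (hxr : ∀ i, x i ∈ (f i).range) :
    ∃ a : ∀ i, A i, (∀ ⦃i j : ι⦄ (h : i ≤ j), TA h (a j) = a i) ∧ ∀ i, f i (a i) = x i := by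
  letI : ∀ i, TopologicalSpace (A i) := fun _ ↦ ⊥
  haveI : ∀ i, DiscreteTopology (A i) := fun _ ↦ ⟨rfl⟩
  haveI : ∀ i, IsTopologicalAddGroup (A i) := fun _ ↦ ⟨⟩
  refine exists_compatible_preimage_of_isCompact_ker hTA (fun _ _ _ ↦ continuous_of_discreteTopology)
    hf (fun i ↦ ?_) hx hxr
  haveI := hfin i
  exact (Set.toFinite ((f i).ker : Set (A i))).isCompact

/-- **Levelwise onto with finite kernels ⟹ onto on compatible families**: if every `f_i` is surjective
with finite kernel, every compatible family of `B` is the image of a compatible family of `A`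
(Atiyah–Macdonald Prop. 10.2, surjectivity clause, for Mittag-Leffler kernel systems over a directed
index set). [cite: AtiyahMacdonald1969, Ch. 10, Prop. 10.2] [cite: Weibel1994, §3.5 Prop. 3.5.7] -/
theorem forall_exists_compatible_preimage_of_surjective_of_finite_ker
    (hTA : ∀ ⦃i j k : ι⦄ (hij : i ≤ j) (hjk : j ≤ k) (x : A k), TA hij (TA hjk x) = TA (hij.trans hjk) x)
    (hf : ∀ ⦃i j : ι⦄ (h : i ≤ j) (y : A j), TB h (f j y) = f i (TA h y))
    (hsurj : ∀ i, Surjective (f i)) (hfin : ∀ i, Finite (f i).ker)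
    (x : ∀ i, B i) (hx : ∀ ⦃i j : ι⦄ (h : i ≤ j), TB h (x j) = x i) :
    ∃ a : ∀ i, A i, (∀ ⦃i j : ι⦄ (h : i ≤ j), TA h (a j) = a i) ∧ ∀ i, f i (a i) = x i :=
  exists_compatible_preimage_of_finite_ker hTA hf hfin hx fun i ↦ hsurj i (x i)

/-- **Middle exactness on compatible families from levelwise exactness, finite kernels**: for maps of
systems `f : A → B`, `g : B → C` with `ker g_i ≤ range f_i` levelwise and every `ker f_i` finite, every
compatible family `x` of `B` killed by `g` is `f(a)` for a compatible family `a` of `A`. The typical use: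
a levelwise exact sequence of FINITE groups over `ℕ × ℕ` stays exact on compatible families.
[cite: AtiyahMacdonald1969, Ch. 10, Prop. 10.2] [cite: Weibel1994, §3.5 Prop. 3.5.7] -/
theorem exists_compatible_preimage_of_ker_le_range_of_finite_ker {C : ι → Type*}
    [∀ i, AddCommGroup (C i)] {g : ∀ i, B i →+ C i}
    (hTA : ∀ ⦃i j k : ι⦄ (hij : i ≤ j) (hjk : j ≤ k) (x : A k), TA hij (TA hjk x) = TA (hij.trans hjk) x)
    (hf : ∀ ⦃i j : ι⦄ (h : i ≤ j) (y : A j), TB h (f j y) = f i (TA h y))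
    (hexact : ∀ i, (g i).ker ≤ (f i).range) (hfin : ∀ i, Finite (f i).ker)
    (x : ∀ i, B i) (hx : ∀ ⦃i j : ι⦄ (h : i ≤ j), TB h (x j) = x i) (hgx : ∀ i, g i (x i) = 0) :
    ∃ a : ∀ i, A i, (∀ ⦃i j : ι⦄ (h : i ≤ j), TA h (a j) = a i) ∧ ∀ i, f i (a i) = x i :=
  exists_compatible_preimage_of_finite_ker hTA hf hfin hx fun i ↦ hexact i ((g i).mem_ker.2 (hgx i))

/-- **Systems of FINITE groups**: for a map `f : A → B` of inverse systems of finite abelian groups over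
a directed index set, every compatible family of `B` lying levelwise in the image of `f` is the image of
a compatible family of `A`. [cite: AtiyahMacdonald1969, Ch. 10, Prop. 10.2] [cite: Weibel1994, §3.5 Prop. 3.5.7] -/
theorem exists_compatible_preimage_of_finite (hA : ∀ i, Finite (A i))
    (hTA : ∀ ⦃i j k : ι⦄ (hij : i ≤ j) (hjk : j ≤ k) (x : A k), TA hij (TA hjk x) = TA (hij.trans hjk) x)
    (hf : ∀ ⦃i j : ι⦄ (h : i ≤ j) (y : A j), TB h (f j y) = f i (TA h y))
    {x : ∀ i, B i} (hx : ∀ ⦃i j : ι⦄ (h : i ≤ j), TB h (x j) = x i)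
    (hxr : ∀ i, x i ∈ (f i).range) :
    ∃ a : ∀ i, A i, (∀ ⦃i j : ι⦄ (h : i ≤ j), TA h (a j) = a i) ∧ ∀ i, f i (a i) = x i :=
  exists_compatible_preimage_of_finite_ker hTA hf
    (fun i ↦ @Finite.of_injective _ _ (hA i) (fun y : (f i).ker ↦ (y : A i)) Subtype.val_injective)
    hx hxr

end Directed

end Literature.Algebra.InverseSystem
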